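import Summits.RiemannHypothesis.RiemannHypothesis.Theorems.WeilGroundStateArchimedeanWindowSimpleEvenGapSound2
import HarnessLib

/-!
# `ArchimedeanWindowSimpleEven` — soundness of the gap certificate, III: the main theorem

`WeilGapCert.gap_of_checkG`: `c.checkG = true` ⟹ for every test function `g` on the window
`[-(log 2)/2, (log 2)/2]` whose moments satisfy the constraint of the even block,
`θ ‖g‖₂² ≤ E(g)` (`E = weilArchQuadratic = Re Q` on the window). The chain is that of
`WeilCert.weilArchQuadratic_nonneg_of_check` (polar lower bound, minorant of `Re ψ(1/4+it/2)`,
frequency bound, Bessel) with two roundings of the matrix (table of moments, then dyadic) and the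
level `θ` kept aside; the finite part is `core_nonneg_gap`.

Route `RiemannHypothesis/WeilGroundState`, item `ArchimedeanWindowSimpleEven` (stmt-RiemannHypothesis-1529).
See `WeilGroundStateArchimedeanWindowSimpleEvenGapDefs.lean` for the certificate format, the data and the
overall plan (LOWER bounds by the gap certificate `weilGapCert`, UPPER bound `ε((log 2)/2) ≤ 3/200` by the
trial function `trialFun`).
-/

namespace Summit.RiemannHypothesis.RiemannHypothesis.Theorems.WeilGroundState

open Literature.NumberTheory.LFunctions

namespace WeilGapCert

open Complex Finset MeasureTheory Set Filter
open scoped Real ComplexConjugate BigOperators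

variable {c : WeilGapCert}

/-! ### The two roundings of the matrix and the scalar side conditions -/

/-- Rounding error of a quadratic form, entries compared on `range m` only. [folklore] -/
theorem quad_rounding_le' (m : ℕ) (A B : ℕ → ℕ → ℝ) (δ L : ℝ) (hδ0 : 0 ≤ δ) (hL : 0 ≤ L)
    (hδ : ∀ k ∈ range m, ∀ l ∈ range m, |A k l - B k l| ≤ δ)
    (M : ℕ → ℂ) (hM : ∀ k, ‖M k‖ ≤ L) :
    ∑ k ∈ range m, ∑ l ∈ range m, A k l * (conj (M k) * M l).re -
        ∑ k ∈ range m, ∑ l ∈ range m, B k l * (conj (M k) * M l).re ≤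
      δ * (m : ℝ) ^ 2 * L ^ 2 := by
  rw [← Finset.sum_sub_distrib]
  simp_rw [← Finset.sum_sub_distrib, ← sub_mul]
  calc ∑ k ∈ range m, ∑ l ∈ range m, (A k l - B k l) * (conj (M k) * M l).re
      ≤ ∑ k ∈ range m, ∑ l ∈ range m, δ * L ^ 2 := by
        refine Finset.sum_le_sum fun k hk ↦ Finset.sum_le_sum fun l hl ↦ ?_
        have h1 : |(conj (M k) * M l).re| ≤ L * L := by
          refine (Complex.abs_re_le_norm _).trans ?_
          rw [norm_mul, Complex.norm_conj]
          exact mul_le_mul (hM k) (hM l) (norm_nonneg _) hL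
        have h2 := hδ k hk l hl
        calc (A k l - B k l) * (conj (M k) * M l).re
            ≤ |(A k l - B k l) * (conj (M k) * M l).re| := le_abs_self _
          _ = |A k l - B k l| * |(conj (M k) * M l).re| := abs_mul _ _
          _ ≤ δ * (L * L) := mul_le_mul h2 h1 (abs_nonneg _) hδ0
          _ = δ * L ^ 2 := by ring
    _ = δ * (m : ℝ) ^ 2 * L ^ 2 := by
        simp only [Finset.sum_const, Finset.card_range, nsmul_eq_mul]
        ring

/-- `invTwoPiHi ≥ 0` (rational form). [folklore] -/
theorem invTwoPiHi_nonneg_rat : (0 : ℚ) ≤ invTwoPiHi := by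
  unfold invTwoPiHi piLo; norm_num

/-- The table moves the matrix `P` by at most `q_π 2^{-pnu}` entrywise on `k, l ≤ N`. [folklore] -/
theorem abs_pmQ_sub_pmQ_le (hA : c.checkNuA = true) (hB : c.checkNuB = true) {k l : ℕ}
    (hk : k < c.base.N + 1) (hl : l < c.base.N + 1) :
    |c.base.pmQ c.nu k l - c.base.pmQ c.base.nuTab k l| ≤ invTwoPiHi / 2 ^ c.pnu := by
  have hq0 : (0 : ℚ) ≤ invTwoPiHi := invTwoPiHi_nonneg_rat
  unfold WeilCert.pmQ
  by_cases hkl : k % 2 = l % 2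
  · rw [if_pos hkl, if_pos hkl]
    have hq : k + l ≤ 2 * c.base.N := by omega
    obtain ⟨h1, h2⟩ := nu_bounds hA hB hq
    rw [WeilCert.getV_nuTab hq]
    have hF : (1 : ℚ) ≤ (k.factorial * l.factorial : ℚ) := by
      have := Nat.factorial_pos k
      have := Nat.factorial_pos l
      exact_mod_cast Nat.one_le_iff_ne_zero.2 (Nat.mul_ne_zero (by omega) (by omega))
    have hs : |((-1 : ℚ) ^ k * (-1) ^ ((k + l) / 2))| = 1 := by
      rw [abs_mul, abs_pow, abs_pow, abs_neg, abs_one, one_pow, one_pow, mul_one]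
    have e : (-1 : ℚ) ^ k * 2 * c.base.tauQ k * c.base.tauQ l -
        invTwoPiHi * ((-1) ^ k * (-1) ^ ((k + l) / 2) * getV c.nu (k + l) / (k.factorial * l.factorial)) -
        ((-1) ^ k * 2 * c.base.tauQ k * c.base.tauQ l -
          invTwoPiHi * ((-1) ^ k * (-1) ^ ((k + l) / 2) * c.base.nuQ (k + l) /
            (k.factorial * l.factorial))) =
        -(((-1 : ℚ) ^ k * (-1) ^ ((k + l) / 2)) *
          (invTwoPiHi * (getV c.nu (k + l) - c.base.nuQ (k + l)) / (k.factorial * l.factorial))) := by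
      ring
    rw [e, abs_neg, abs_mul, hs, one_mul, abs_div, abs_mul, abs_of_nonneg hq0,
      abs_of_nonneg (by linarith), abs_of_pos (by linarith)]
    rw [div_le_div_iff₀ (by linarith) (by positivity)]
    have h3 : invTwoPiHi * (getV c.nu (k + l) - c.base.nuQ (k + l)) ≤ invTwoPiHi * (1 / 2 ^ c.pnu) :=
      mul_le_mul_of_nonneg_left (by linarith) hq0
    calc invTwoPiHi * (getV c.nu (k + l) - c.base.nuQ (k + l)) * 2 ^ c.pnu
        ≤ invTwoPiHi * (1 / 2 ^ c.pnu) * 2 ^ c.pnu := mul_le_mul_of_nonneg_right h3 (by positivity)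
      _ = invTwoPiHi * 1 := by field_simp
      _ ≤ invTwoPiHi * (k.factorial * l.factorial : ℚ) := mul_le_mul_of_nonneg_left hF hq0
  · rw [if_neg hkl, if_neg hkl, sub_zero, abs_zero]
    positivity

/-- `rd` is monotone. [folklore] -/
theorem ratRd_mono (p : ℕ) {x y : ℚ} (h : x ≤ y) : ratRd p x ≤ ratRd p y := by
  unfold ratRd
  exact div_le_div_of_nonneg_right (by exact_mod_cast Int.floor_le_floor (by nlinarith [pow_pos (two_pos (α := ℚ)) p]))
    (by positivity)

/-- The scalar side conditions transfer from the table to the exact moments: the only entry that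
differs is `κ`, and `κ(ν) ≥ κ(nu) ≥ θ + nuErr... ≥ 0` because `nu[N+1] ≥ ν_{N+1}`. [folklore] -/
theorem checkScalars_nuTab (hsc : c.base.checkScalars c.nu = true) (hA : c.checkNuA = true)
    (hB : c.checkNuB = true) : c.base.checkScalars c.base.nuTab = true := by
  obtain ⟨h2a, ha1, hT, haT, hρT, hN, hκ⟩ := WeilCert.scalars_spec hsc
  have ha0 : 0 ≤ c.base.a0 := by
    have : (0 : ℚ) ≤ logTwoHi := by unfold logTwoHi; norm_num
    linarith
  have hq : c.base.N + 1 ≤ 2 * c.base.N := by omega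
  obtain ⟨h1, -⟩ := nu_bounds hA hB hq
  rw [← WeilCert.getV_nuTab hq] at h1
  have hnp : c.base.nuPrime c.base.nuTab ≤ c.base.nuPrime c.nu := by
    unfold WeilCert.nuPrime
    exact div_le_div_of_nonneg_right (by linarith) (by positivity)
  have hke : c.base.kappaExact c.nu ≤ c.base.kappaExact c.base.nuTab := by
    unfold WeilCert.kappaExact
    have hprod : 0 ≤ 2 * c.base.a0 * (5 * invTwoPiHi *
        (c.base.nuPrime c.nu - c.base.nuPrime c.base.nuTab)) :=
      mul_nonneg (mul_nonneg (by norm_num) ha0)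
        (mul_nonneg (mul_nonneg (by norm_num) invTwoPiHi_nonneg_rat) (sub_nonneg.2 hnp))
    linarith
  have hκ' : 0 ≤ c.base.kappaQ c.base.nuTab :=
    hκ.trans (ratRd_mono _ hke)
  unfold WeilCert.checkScalars
  simp only [Bool.and_eq_true, decide_eq_true_eq]
  exact ⟨⟨⟨⟨⟨⟨h2a, ha1⟩, hT⟩, haT⟩, hρT⟩, hN⟩, hκ'⟩

/-! ### The main theorem -/

/-- **Soundness of the gap certificate.** If `c.checkG = true` then for every test function `g` with
`tsupport g ⊆ [-(log 2)/2, (log 2)/2]` whose moments satisfy the constraint of the even block,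
`Σ_j c_j y_j(g) = 0` (`y = C M`, `M_k = ∫ g(x) (x/a₀)^k dx`), one has `θ ‖g‖₂² ≤ E(g)`
(Yoshida's analytic form `E = weilArchQuadratic`, `= Re Q(g)` on the window). The proof is the chain
of `WeilCert.weilArchQuadratic_nonneg_of_check` (polar lower bound, minorant of the weight, frequency
bound, the two roundings of the matrix, Bessel's inequality) with the level `θ` kept aside and the
algebraic core `core_nonneg_gap`. [folklore] -/
theorem gap_of_checkG (h : c.checkG = true) {g : ℝ → ℂ} (hg : IsWeilTest g)
    (hsupp : tsupport g ⊆ Icc (-(Real.log 2 / 2)) (Real.log 2 / 2))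
    (hcon : ∑ j ∈ range c.base.nb,
      (getV c.cvec j : ℂ) * c.base.yVec (weilMoment (c.base.a0 : ℝ) g) 0 j = 0) :
    (c.theta : ℝ) * weilNorm2Sq g ≤ weilArchQuadratic g := by
  obtain ⟨hcells, hsc, hκG, hnA, hnB, hb0, hb1⟩ := checkG_spec h
  obtain ⟨h2a, ha1q, hT, haT, hρT, hN, hκ⟩ := WeilCert.scalars_spec hsc
  have hsc' := checkScalars_nuTab hsc hnA hnB
  set a : ℝ := (c.base.a0 : ℝ) with ha_def
  have hlog : Real.log 2 / 2 ≤ a := log_two_half_le_of_check h2a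
  have ha : 0 < a := lt_of_lt_of_le (by have := Real.log_pos one_lt_two; positivity) hlog
  have ha1 : a ≤ 1 := by rw [ha_def]; exact_mod_cast ha1q
  have hsupp' : tsupport g ⊆ Icc (-a) a := hsupp.trans (Icc_subset_Icc (by linarith) hlog)
  set n := c.base.N + 1 with hn
  set nu := c.nu with hnu
  set M : ℕ → ℂ := weilMoment a g with hM
  set L := weilNorm1 g with hL
  set N2 := weilNorm2Sq g with hN2
  set z : ℕ → ℕ → ℝ := fun k l ↦ (conj (M k) * M l).re with hz
  have hzsym : ∀ k l, z k l = z l k := fun k l ↦ by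
    rw [hz]; simp only; rw [← WeilAna.re_mul_conj_eq, mul_comm]
  have hL0 : 0 ≤ L := weilNorm1_nonneg g
  have hN20 : 0 ≤ N2 := weilNorm2Sq_nonneg g
  have hL1 : L ^ 2 ≤ 2 * a * N2 := weilNorm1_sq_le hg ha hsupp'
  -- the three terms of E(g)
  set P : ℝ := 2 * (weilMellin g 0 * conj (weilMellin g 1)).re with hP
  set A : ℝ := ∫ t : ℝ, ‖weilMellin g (1 / 2 + t * I)‖ ^ 2 *
    Literature.Analysis.SpecialFunctions.reDigammaQuarter t with hA
  set Γ : ℝ := ∫ t : ℝ, ‖weilMellin g (1 / 2 + t * I)‖ ^ 2 * cellsGamma c.base.wL c.base.cells t with hΓ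
  have hE : weilArchQuadratic g = P - Real.log π * N2 + 1 / (2 * π) * A := by
    rw [weilArchQuadratic_eq]; rfl
  -- Step A
  set ρ : ℝ := 2 * (a / 2) ^ (c.base.N + 1) / (c.base.N + 1).factorial with hρ
  have hρ0 : 0 ≤ ρ := by positivity
  have hPA : ∑ k ∈ range n, ∑ l ∈ range n,
      (2 * ((-a / 2) ^ k / k.factorial) * ((a / 2) ^ l / l.factorial)) * z k l -
      (8 * ρ + 6 * ρ ^ 2) * L ^ 2 ≤ P := WeilAna.polar_lower_bound hg ha ha1 hsupp' c.base.N
  rw [WeilCert.polar_symmetrize n a z hzsym] at hPA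
  -- Step B
  have hB : (c.base.wL : ℝ) * (2 * π * N2) - Γ ≤ A := WeilCert.arch_lower_bound hcells hg
  -- Step C
  have hC : Γ ≤ ∑ k ∈ range n, ∑ l ∈ range n, WeilCert.gHat c.base k l * z k l +
      5 * L ^ 2 * (c.base.nuPrime c.base.nuTab : ℝ) := by
    have := WeilCert.freq_integral_bound hcells hsc' hg (by rwa [← ha_def])
    rw [← ha_def] at this
    exact this
  have hΓ0 : 0 ≤ Γ := integral_nonneg fun t ↦ mul_nonneg (sq_nonneg _) (cellsGamma_nonneg hcells t)
  -- constants
  set q : ℝ := ((invTwoPiHi : ℚ) : ℝ) with hq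
  have hq1 : 1 / (2 * π) ≤ q := invTwoPiHi_ge
  have hq0 : 0 ≤ q := invTwoPiHi_nonneg
  have hlogpi : Real.log π ≤ ((logPiHi : ℚ) : ℝ) := logPiHi_ge
  have ha0q : (0 : ℚ) ≤ c.base.a0 := by
    have := ha.le; rw [ha_def] at this; exact_mod_cast this
  have hν0 : 0 ≤ ((c.base.nuPrime c.base.nuTab : ℚ) : ℝ) := by
    unfold WeilCert.nuPrime
    rw [WeilCert.getV_nuTab (by omega)]
    push_cast
    have := WeilCert.nuQ_nonneg hcells ha0q (q := c.base.N + 1) ⟨c.base.nb, by omega⟩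
    positivity
  have hνle : ((c.base.nuPrime c.base.nuTab : ℚ) : ℝ) ≤ ((c.base.nuPrime nu : ℚ) : ℝ) := by
    have hqq : c.base.N + 1 ≤ 2 * c.base.N := by omega
    obtain ⟨h1, -⟩ := nu_bounds hnA hnB hqq
    rw [← WeilCert.getV_nuTab hqq] at h1
    unfold WeilCert.nuPrime
    exact_mod_cast div_le_div_of_nonneg_right (by linarith) (by positivity)
  have hpi : 0 < 1 / (2 * π) := by positivity
  -- combine A, B, C
  have hB' : (c.base.wL : ℝ) * N2 - 1 / (2 * π) * Γ ≤ 1 / (2 * π) * A := by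
    calc (c.base.wL : ℝ) * N2 - 1 / (2 * π) * Γ
        = 1 / (2 * π) * ((c.base.wL : ℝ) * (2 * π * N2) - Γ) := by field_simp
      _ ≤ 1 / (2 * π) * A := mul_le_mul_of_nonneg_left hB hpi.le
  have h3 : 1 / (2 * π) * Γ ≤ q * Γ := mul_le_mul_of_nonneg_right hq1 hΓ0
  have h4 : q * Γ ≤ q * (∑ k ∈ range n, ∑ l ∈ range n, WeilCert.gHat c.base k l * z k l +
      5 * L ^ 2 * (c.base.nuPrime c.base.nuTab : ℝ)) := mul_le_mul_of_nonneg_left hC hq0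
  have h4' : q * (5 * L ^ 2 * ((c.base.nuPrime c.base.nuTab : ℚ) : ℝ)) ≤
      q * (5 * L ^ 2 * ((c.base.nuPrime nu : ℚ) : ℝ)) :=
    mul_le_mul_of_nonneg_left (mul_le_mul_of_nonneg_left hνle (by positivity)) hq0
  have h5 : Real.log π * N2 ≤ ((logPiHi : ℚ) : ℝ) * N2 := mul_le_mul_of_nonneg_right hlogpi hN20
  have step1 : ∑ k ∈ range n, ∑ l ∈ range n,
      ((if k % 2 = l % 2 then
        (-1 : ℝ) ^ k * 2 * ((a / 2) ^ k / k.factorial) * ((a / 2) ^ l / l.factorial) else 0) -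
        q * WeilCert.gHat c.base k l) * z k l +
      ((c.base.wL : ℝ) - (logPiHi : ℚ)) * N2 -
      ((8 * ρ + 6 * ρ ^ 2) + 5 * q * (c.base.nuPrime nu : ℝ)) * L ^ 2 ≤ weilArchQuadratic g := by
    rw [hE]
    have e1 : ∑ k ∈ range n, ∑ l ∈ range n,
        ((if k % 2 = l % 2 then
          (-1 : ℝ) ^ k * 2 * ((a / 2) ^ k / k.factorial) * ((a / 2) ^ l / l.factorial) else 0) -
          q * WeilCert.gHat c.base k l) * z k l =
        ∑ k ∈ range n, ∑ l ∈ range n,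
          (if k % 2 = l % 2 then
            (-1 : ℝ) ^ k * 2 * ((a / 2) ^ k / k.factorial) * ((a / 2) ^ l / l.factorial) else 0) * z k l -
        q * ∑ k ∈ range n, ∑ l ∈ range n, WeilCert.gHat c.base k l * z k l := by
      rw [Finset.mul_sum, ← Finset.sum_sub_distrib]
      refine Finset.sum_congr rfl fun k _ ↦ ?_
      rw [Finset.mul_sum, ← Finset.sum_sub_distrib]
      refine Finset.sum_congr rfl fun l _ ↦ ?_
      ring
    rw [e1]
    have h4'' : q * (∑ k ∈ range n, ∑ l ∈ range n, WeilCert.gHat c.base k l * z k l +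
        5 * L ^ 2 * (c.base.nuPrime c.base.nuTab : ℝ)) ≤
        q * (∑ k ∈ range n, ∑ l ∈ range n, WeilCert.gHat c.base k l * z k l) +
          q * (5 * L ^ 2 * ((c.base.nuPrime nu : ℚ) : ℝ)) := by
      rw [mul_add]; linarith [h4']
    linarith [hPA, hB', h3, h4, h5, h4'']
  -- rewrite the matrix as `pmQ nuTab`
  have step2 : ∑ k ∈ range n, ∑ l ∈ range n,
      ((if k % 2 = l % 2 then
        (-1 : ℝ) ^ k * 2 * ((a / 2) ^ k / k.factorial) * ((a / 2) ^ l / l.factorial) else 0) -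
        q * WeilCert.gHat c.base k l) * z k l =
      ∑ k ∈ range n, ∑ l ∈ range n, ((c.base.pmQ c.base.nuTab k l : ℚ) : ℝ) * z k l := by
    refine Finset.sum_congr rfl fun k hk ↦ Finset.sum_congr rfl fun l hl ↦ ?_
    rw [WeilCert.pmQ_cast (Finset.mem_range.1 hk) (Finset.mem_range.1 hl)]
  rw [step2] at step1
  -- the two roundings: `prQ nu` vs `pmQ nuTab`
  have hMk : ∀ k, ‖M k‖ ≤ L := fun k ↦ norm_weilMoment_le hg ha hsupp' k
  set δ : ℝ := 1 / 2 ^ c.base.pg + q * (1 / 2 ^ c.pnu) with hδ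
  have hδ0 : 0 ≤ δ := by positivity
  have hround : ∑ k ∈ range n, ∑ l ∈ range n, ((c.base.prQ nu k l : ℚ) : ℝ) * z k l -
      ∑ k ∈ range n, ∑ l ∈ range n, ((c.base.pmQ c.base.nuTab k l : ℚ) : ℝ) * z k l ≤
      δ * (n : ℝ) ^ 2 * L ^ 2 := by
    refine quad_rounding_le' n (fun k l ↦ ((c.base.prQ nu k l : ℚ) : ℝ))
      (fun k l ↦ ((c.base.pmQ c.base.nuTab k l : ℚ) : ℝ)) δ L hδ0 hL0 (fun k hk l hl ↦ ?_) M hMk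
    have e : ((c.base.prQ nu k l : ℚ) : ℝ) - ((c.base.pmQ c.base.nuTab k l : ℚ) : ℝ) =
        (((c.base.prQ nu k l : ℚ) : ℝ) - ((c.base.pmQ nu k l : ℚ) : ℝ)) +
          (((c.base.pmQ nu k l : ℚ) : ℝ) - ((c.base.pmQ c.base.nuTab k l : ℚ) : ℝ)) := by ring
    rw [e]
    refine (abs_add_le _ _).trans (add_le_add ?_ ?_)
    · rw [abs_sub_comm]
      unfold WeilCert.prQ
      exact abs_cast_sub_ratRd_le c.base.pg (c.base.pmQ nu k l)
    · have := abs_pmQ_sub_pmQ_le hnA hnB (Finset.mem_range.1 hk) (Finset.mem_range.1 hl)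
      have h' : |((c.base.pmQ nu k l : ℚ) : ℝ) - ((c.base.pmQ c.base.nuTab k l : ℚ) : ℝ)| =
          ((|c.base.pmQ c.nu k l - c.base.pmQ c.base.nuTab k l| : ℚ) : ℝ) := by
        rw [hnu]; push_cast; rfl
      rw [h', hq, show ((invTwoPiHi : ℚ) : ℝ) * (1 / 2 ^ c.pnu) = ((invTwoPiHi / 2 ^ c.pnu : ℚ) : ℝ) by
        push_cast; ring]
      exact_mod_cast this
  -- κ_exact and nuErr
  have hcoef : 0 ≤ (8 * ρ + 6 * ρ ^ 2) + 5 * q * (c.base.nuPrime nu : ℝ) + δ * (n : ℝ) ^ 2 := by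
    have : 0 ≤ ((c.base.nuPrime nu : ℚ) : ℝ) := hν0.trans hνle
    positivity
  have hkex : ((c.base.kappaExact nu : ℚ) : ℝ) - (c.nuErrQ : ℝ) =
      ((c.base.wL : ℝ) - (logPiHi : ℚ)) -
        2 * a * ((8 * ρ + 6 * ρ ^ 2) + 5 * q * (c.base.nuPrime nu : ℝ) + δ * (n : ℝ) ^ 2) := by
    unfold WeilCert.kappaExact WeilCert.etaP WeilCert.rhoE nuErrQ
    push_cast
    rw [hρ, hδ, hq, hn, ha_def]
    push_cast
    ring
  have hκle : ((c.base.kappaQ nu : ℚ) : ℝ) ≤ ((c.base.kappaExact nu : ℚ) : ℝ) := by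
    unfold WeilCert.kappaQ; exact_mod_cast ratRd_le c.base.pg _
  have hκG' : (0 : ℝ) ≤ (c.kappaG : ℝ) := by exact_mod_cast hκG
  have hkG : (c.kappaG : ℝ) = ((c.base.kappaQ nu : ℚ) : ℝ) - (c.theta : ℝ) - (c.nuErrQ : ℝ) := by
    rw [kappaG, hnu]; push_cast; ring
  -- E − θ N2 ≥ Σ pr z + κ' N2
  have step3 : ∑ k ∈ range n, ∑ l ∈ range n, ((c.base.prQ nu k l : ℚ) : ℝ) * z k l +
      ((c.kappaG : ℝ) + (c.theta : ℝ)) * N2 ≤ weilArchQuadratic g := by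
    have h1 : (((c.base.kappaQ nu : ℚ) : ℝ) - (c.nuErrQ : ℝ)) * N2 ≤
        (((c.base.kappaExact nu : ℚ) : ℝ) - (c.nuErrQ : ℝ)) * N2 :=
      mul_le_mul_of_nonneg_right (by linarith) hN20
    rw [hkex] at h1
    have h2 := mul_le_mul_of_nonneg_left hL1 hcoef
    have e3 : ((c.kappaG : ℝ) + (c.theta : ℝ)) = ((c.base.kappaQ nu : ℚ) : ℝ) - (c.nuErrQ : ℝ) := by
      rw [hkG]; ring
    rw [e3]
    linarith [step1, hround, h1, h2]
  -- Bessel and the algebraic core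
  have hbes : 2 * (∑ k ∈ range n, conj (c.base.uVec M k) * M k).re -
      (∑ k ∈ range n, ∑ l ∈ range n,
        conj (c.base.uVec M k) * c.base.uVec M l * (gramH a k l : ℂ)).re ≤ N2 :=
    weilNorm2Sq_ge_bessel hg ha hsupp' n (c.base.uVec M)
  have hcore : 0 ≤ (∑ k ∈ range n, ∑ l ∈ range n, ((c.base.prQ nu k l : ℚ) : ℝ) * z k l) +
      (c.kappaG : ℝ) *
        (2 * (∑ k ∈ range n, conj (c.base.uVec M k) * M k).re -
          (∑ k ∈ range n, ∑ l ∈ range n,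
            conj (c.base.uVec M k) * c.base.uVec M l * (gramH a k l : ℂ)).re) := by
    have := core_nonneg_gap (c := c) hN hb0 hb1 a ha_def.symm M hcon
    rw [← hn] at this
    exact this
  have h6 := mul_le_mul_of_nonneg_left hbes hκG'
  linarith [step3, h6, hcore]

end WeilGapCert

end Summit.RiemannHypothesis.RiemannHypothesis.Theorems.WeilGroundState
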